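import Mathlib

/-!
# SoloBlind — texture form of zero-temperature Gaussian domination (abstract duality)

Solo programme `solo-AtomisticToContinuum-blind`, session 5, §12.7.7 of the solo paper.

Informal setting (NOT formalised): lattice bosons / quantum XY model with grand-canonical Hamiltonian
`H_μ = H - μ N̂`, ground level `E₀(μ)`, bond fields `h`, the perturbation `B_h = ∑_b h_b (S¹_x - S¹_y)` and
`c_h = ½ ∑_b h_b²`.  Zero-temperature Gaussian domination is the family of inequalities
`E₀(H_μ - ε B_h) ≥ E₀(H_μ) - ε² c_h` (all real `ε`, all real `h`); at half filling, `μ = 0`, it is the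
`β → ∞` case of Dyson–Lieb–Simon / Lieb–Seiringer–Solovej–Yngvason (11.12), proved by reflection positivity.
Since `E₀(H_μ - ε B_h) = inf_ψ (⟨H_μ⟩_ψ - ε ⟨B_h⟩_ψ)` and `⟨B_h⟩_ψ = ⟨h, ∇ m_ψ⟩` with the in-plane
magnetisation profile `m_ψ(x) = ⟨S¹_x⟩_ψ`, Gaussian domination is equivalent, by completing a square, to the
TEXTURE INEQUALITY: for every state `ψ`, `⟨H_μ⟩_ψ - E₀(μ) ≥ ½ ‖∇ m_ψ‖²` — the excitation energy of any
many-body state dominates half the Dirichlet energy of its order-parameter profile.  This file records that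
equivalence over an arbitrary state type `S`, an energy functional `E : S → ℝ`, a ground level `E0`, and a
"profile gradient" `G : S → F` into a real inner-product space of fields (so `⟨B_h⟩_ψ = ⟪h, G ψ⟫`,
`c_h = ‖h‖²/2`), together with the single-direction version (fixed `h`), which is a discriminant condition and is
what an exact-diagonalisation test of one field direction measures.  No operator theory is used.
-/

namespace Summit.AtomisticToContinuum.BoseEinsteinCondensation.Theorems

open scoped InnerProductSpace

/-- Single field direction: Gaussian domination along `h` (response `M ψ = ⟨B_h⟩_ψ`, constant `c = c_h > 0`)
holds for every amplitude `ε` iff the squared response of every state is bounded by `4 c` times its excitation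
energy (the discriminant of the quadratic in `ε`). -/
theorem gd_direction_iff_sq_response_le {S : Type*} (E M : S → ℝ) (E0 c : ℝ) (hc : 0 < c) :
    (∀ ε : ℝ, ∀ ψ : S, E0 - ε ^ 2 * c ≤ E ψ - ε * M ψ) ↔
      (∀ ψ : S, (M ψ) ^ 2 ≤ 4 * c * (E ψ - E0)) := by
  constructor
  · intro h ψ
    have hq : ∀ x : ℝ, 0 ≤ c * (x * x) + (-M ψ) * x + (E ψ - E0) := by
      intro x
      have := h x ψ
      nlinarith
    have hd := discrim_le_zero hq
    rw [discrim] at hd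
    nlinarith
  · intro h ε ψ
    have h1 := h ψ
    -- complete the square: c ε² - M ε + (E - E0) = c (ε - M/(2c))² + (E - E0 - M²/(4c)) ≥ 0
    have h2 : 0 ≤ c * (ε - M ψ / (2 * c)) ^ 2 := mul_nonneg hc.le (sq_nonneg _)
    have h3 : c * (ε - M ψ / (2 * c)) ^ 2 = c * ε ^ 2 - M ψ * ε + (M ψ) ^ 2 / (4 * c) := by
      field_simp
      ring
    have h4 : (M ψ) ^ 2 / (4 * c) ≤ E ψ - E0 := by
      rw [div_le_iff₀ (by positivity)]
      linarith
    nlinarith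

/-- **Texture duality.**  Gaussian domination for all fields `h` and all amplitudes,
`E0 - ε² ‖h‖²/2 ≤ E ψ - ε ⟪h, G ψ⟫`, is equivalent to the texture inequality `‖G ψ‖²/2 ≤ E ψ - E0` for every
state (`G ψ` = gradient of the order-parameter profile of `ψ`). -/
theorem gd_iff_texture {S F : Type*} [NormedAddCommGroup F] [InnerProductSpace ℝ F]
    (E : S → ℝ) (E0 : ℝ) (G : S → F) :
    (∀ h : F, ∀ ε : ℝ, ∀ ψ : S, E0 - ε ^ 2 * (‖h‖ ^ 2 / 2) ≤ E ψ - ε * ⟪h, G ψ⟫_ℝ) ↔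
      (∀ ψ : S, ‖G ψ‖ ^ 2 / 2 ≤ E ψ - E0) := by
  constructor
  · intro hgd ψ
    have := hgd (G ψ) 1 ψ
    rw [real_inner_self_eq_norm_sq] at this
    linarith
  · intro htex h ε ψ
    have h1 := htex ψ
    have h2 : 0 ≤ ‖ε • h - G ψ‖ ^ 2 := sq_nonneg _
    have h3 : ‖ε • h - G ψ‖ ^ 2 = ε ^ 2 * ‖h‖ ^ 2 - 2 * (ε * ⟪h, G ψ⟫_ℝ) + ‖G ψ‖ ^ 2 := by
      rw [norm_sub_sq_real, norm_smul, mul_pow, Real.norm_eq_abs, sq_abs, real_inner_smul_left]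
    nlinarith

/-- The optimal field for a given state is its own profile gradient: under Gaussian domination the
largest admissible quadratic response `sup_h ⟪h, G ψ⟫² / (2‖h‖²)` equals `‖G ψ‖²/2` (Cauchy–Schwarz), so testing
plane-wave directions `h` bounds the texture functional from below, with equality on the maximiser `h = G ψ`. -/
theorem sq_response_le_texture {S F : Type*} [NormedAddCommGroup F] [InnerProductSpace ℝ F]
    (G : S → F) (h : F) (ψ : S) :
    ⟪h, G ψ⟫_ℝ ^ 2 ≤ 2 * ‖h‖ ^ 2 * (‖G ψ‖ ^ 2 / 2) := by
  have := abs_real_inner_le_norm h (G ψ)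
  have h0 : 0 ≤ ‖h‖ * ‖G ψ‖ := by positivity
  have h1 : |⟪h, G ψ⟫_ℝ| ^ 2 ≤ (‖h‖ * ‖G ψ‖) ^ 2 := pow_le_pow_left₀ (abs_nonneg _) this 2
  rw [sq_abs] at h1
  nlinarith

/-- Consequence used by the bookkeeping: the texture inequality with a constant `C` (i.e.
`‖G ψ‖²/2 ≤ C (E ψ - E0)`) gives Gaussian domination with constant `C` in every direction:
`⟪h, G ψ⟫² ≤ 4 (C ‖h‖²/2) (E ψ - E0)`, the single-direction form with `c = C c_h`. -/
theorem gd_direction_of_texture_const {S F : Type*} [NormedAddCommGroup F] [InnerProductSpace ℝ F]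
    (E : S → ℝ) (E0 C : ℝ) (G : S → F)
    (htex : ∀ ψ : S, ‖G ψ‖ ^ 2 / 2 ≤ C * (E ψ - E0)) (h : F) (ψ : S) :
    ⟪h, G ψ⟫_ℝ ^ 2 ≤ 4 * (C * (‖h‖ ^ 2 / 2)) * (E ψ - E0) := by
  have h1 := sq_response_le_texture G h ψ
  have h2 := htex ψ
  have h3 : 0 ≤ ‖h‖ ^ 2 := sq_nonneg _
  have h4 : 2 * ‖h‖ ^ 2 * (‖G ψ‖ ^ 2 / 2) ≤ 2 * ‖h‖ ^ 2 * (C * (E ψ - E0)) :=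
    mul_le_mul_of_nonneg_left h2 (by positivity)
  nlinarith

end Summit.AtomisticToContinuum.BoseEinsteinCondensation.Theorems
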